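/-
Copyright (c) 2026 the pub-hodgecm-mathlib formalisation cell (harness21).  Prover seat hodgecm-mathlib-K2E5-p17 (g3) (free E5 hand on the E3 road),
Track B «K2-LIT» ∕ h413 (`stmt-HodgeConjecture-24833`), line `K2_E3_EllipticInputs`, unit U12-d, §L: LEMMAS for brick (A) of the Lie–Weyl road (b-ii) to the
leaf (LBGL-2b) — cell algebra in `GL₂(𝒪)` and the `𝒪`-averaging lemma on `F`.  2026-09-04.
-/
import Summits.HodgeConjecture.HodgeConjecture.Theorems.K2E3GL2RegularNilpotentFourierLineInversion   -- ★ (b-i) (this seat); brings ★ `glInt` kit, `primePowBall`, local-field Haar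
import Literature.NumberTheory.Automorphic.IwahoriGLTwoIndex                                          -- ★ `exists_mem_glInt_coe_eq_lowerUnipotent`, ★ `…_eq_swap`, ★ `mem_glInt_of_isIntegralMatrix`
import HarnessLib

/-!
# K2_E3 road (h413), §L — (LBGL-2b) brick (A), LEMMAS: the two cells of `GL₂(𝒪)` and the `𝒪`-averaging lemma

Cell `pub/hodgecm-mathlib` (D-0151), Track B, seat K2E5-p17 (g3) (§L lead K2E3-p12 (g4) RULINGS #3 (SL-9): «(A) = K2E5-p17 (g3)»; consumer K2E5-p10 (g4)).
`--supports stmt-HodgeConjecture-24833 --as helper`; THEOREMS ONLY (no definition ∕ instance ∕ notation ∕ named fact ∕ `sorry`); never imports `Cruxes/…/Lines`.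
COUNT-NEUTRAL.  This file holds the two self-contained ingredients of the HEAD file `K2E3GL2IntegralPointsBruhatCells` (split for the 400-line rule):
* §1 ALGEBRA IN `K = GL₂(𝒪)`: the units pattern of the two cells (`|k₀₀| < 1 ⇒ |k₁₀| = 1` and `|k₁₀| < 1 ⇒ |k₀₀| = 1`, from `|det k| = 1`), the matrices of
  `n⁻(x)·X`, `w·X`, `w(t)⁻¹·X`, and the two CELL FACTORISATIONS read by a right-`B(𝒪)`-invariant `Ψ`: `Ψ(k) = Ψ(n⁻(k₁₀∕k₀₀))` on `K₁` (`apply_eq_apply_lowerUni`),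
  `Ψ(k) = Ψ(w(k₀₀∕k₁₀))` on `K₂` (`apply_eq_apply_swapT`), with `n⁻(s) = [[1,0],[s,1]]`, `w(t) = [[t,1],[1,0]]` in `K` (`exists_glInt_lowerUni`, `exists_glInt_swapT`).
* §2 THE AVERAGING LEMMA on `F`: a finite measure carried by `𝒪 = primePowBall F 0` and invariant under translation by `𝒪` is `(m(𝒪)∕dx(𝒪)) · dx|_𝒪`
  (`measure_mul_measure_eq_of_forall_preimage_add`, `eq_smul_restrict_of_forall_preimage_add`; Tonelli on `1_A(y + x)` over `𝒪 × F` — the additive,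
  compact-open-subgroup case of Haar uniqueness on a window, cf. ★ `Literature.MeasureTheory.Group.HaarLocalChart`).
[Serre1980Trees, Ch. II §1.1] [IwahoriMatsumoto1965, §2 Prop. 2.4] [Folland1995, §2.2 Thm. 2.20].
HONEST LABEL: HC_CM is proved only modulo the 7 printed citations (2 remaining named inputs: hLiu418 = stmt-HodgeConjecture-24832, h413 = stmt-HodgeConjecture-24833)
until rung 0 closes; count-neutral helper.
-/

set_option autoImplicit false
set_option linter.dupNamespace false   -- `Summit.HodgeConjecture.HodgeConjecture.…` (D-0017 nested layout; lakefile exemption for Summits)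

noncomputable section

open MeasureTheory Measure Filter Topology Set
open scoped MatrixGroups NNReal ENNReal Pointwise ValuativeRel
open ValuativeRel
open Literature.NumberTheory.Rogawski1990 Literature.NumberTheory.Automorphic Literature.NumberTheory.Automorphic.LocalFieldHaar
open Literature.NumberTheory.GaloisRepresentations Literature.NumberTheory.GaloisRepresentations.IsNonarchimedeanLocalField

namespace Summit.HodgeConjecture.HodgeConjecture.Cruxes.H413.K2E3GL2IntegralPointsCellLemmas

variable {F : Type*} [Field F] [ValuativeRel F]

/-! ## §1  Algebra in `GL₂(𝒪)`: the units pattern of a cell, the two cell factorisations -/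

/-- In an ordered monoid with zero: `a ≤ 1`, `b ≤ 1`, `a b = 1` force `a = 1`. [folklore] -/
theorem valuation_eq_one_of_mul_eq_one {a b : ValueGroupWithZero F} (ha : a ≤ 1) (hb : b ≤ 1) (h : a * b = 1) : a = 1 :=
  le_antisymm ha (by calc (1 : ValueGroupWithZero F) = a * b := h.symm
                          _ ≤ a * 1 := mul_le_mul' le_rfl hb
                          _ = a := mul_one a)

/-- Entries of an element of `GL₂(𝒪)` are integral. [cite: Serre1980Trees, Ch. II §1.1] -/
theorem valuation_apply_le_one {k : GL (Fin 2) F} (hk : k ∈ glInt 2 F) (i j : Fin 2) :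
    valuation F ((k : Matrix (Fin 2) (Fin 2) F) i j) ≤ 1 :=
  (Valuation.mem_integer_iff _ _).1 (((mem_glInt_iff k).1 hk).1 i j)

/-- **Cell `K₂` pattern**: if `k ∈ GL₂(𝒪)` has `|k₀₀| < 1` then `|k₁₀| = 1` (from `|det k| = 1` and the ultrametric inequality). [cite: Serre1980Trees, Ch. II §1.1] -/
theorem valuation_apply_one_zero_eq_one {k : GL (Fin 2) F} (hk : k ∈ glInt 2 F)
    (h : valuation F ((k : Matrix (Fin 2) (Fin 2) F) 0 0) < 1) : valuation F ((k : Matrix (Fin 2) (Fin 2) F) 1 0) = 1 := by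
  have hdet := valuation_det_eq_one_of_mem_glInt hk
  rw [Matrix.det_fin_two] at hdet
  have hle := valuation_apply_le_one hk
  -- `|k₀₀ k₁₁| < 1`, so `|k₀₁ k₁₀| = 1`
  have h1 : valuation F ((k : Matrix (Fin 2) (Fin 2) F) 0 0 * (k : Matrix (Fin 2) (Fin 2) F) 1 1) < 1 := by
    rw [map_mul]
    calc valuation F ((k : Matrix (Fin 2) (Fin 2) F) 0 0) * valuation F ((k : Matrix (Fin 2) (Fin 2) F) 1 1)
        ≤ valuation F ((k : Matrix (Fin 2) (Fin 2) F) 0 0) * 1 := mul_le_mul' le_rfl (hle 1 1)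
      _ < 1 := by rw [mul_one]; exact h
  have h2 : valuation F ((k : Matrix (Fin 2) (Fin 2) F) 0 1 * (k : Matrix (Fin 2) (Fin 2) F) 1 0) = 1 := by
    by_contra hne
    have hlt : valuation F ((k : Matrix (Fin 2) (Fin 2) F) 0 1 * (k : Matrix (Fin 2) (Fin 2) F) 1 0) < 1 :=
      lt_of_le_of_ne (by rw [map_mul]; exact mul_le_one' (hle 0 1) (hle 1 0)) hne
    have := Valuation.map_sub (valuation F) ((k : Matrix (Fin 2) (Fin 2) F) 0 0 * (k : Matrix (Fin 2) (Fin 2) F) 1 1)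
      ((k : Matrix (Fin 2) (Fin 2) F) 0 1 * (k : Matrix (Fin 2) (Fin 2) F) 1 0)
    rw [hdet] at this
    exact absurd this (not_le.2 (max_lt h1 hlt))
  rw [map_mul, mul_comm] at h2
  exact valuation_eq_one_of_mul_eq_one (hle 1 0) (hle 0 1) h2

/-- **Cell `K₁` pattern**: if `k ∈ GL₂(𝒪)` has `|k₁₀| < 1` then `|k₀₀| = 1`. [cite: Serre1980Trees, Ch. II §1.1] -/
theorem valuation_apply_zero_zero_eq_one {k : GL (Fin 2) F} (hk : k ∈ glInt 2 F)
    (h : valuation F ((k : Matrix (Fin 2) (Fin 2) F) 1 0) < 1) : valuation F ((k : Matrix (Fin 2) (Fin 2) F) 0 0) = 1 := by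
  have hdet := valuation_det_eq_one_of_mem_glInt hk
  rw [Matrix.det_fin_two] at hdet
  have hle := valuation_apply_le_one hk
  have h1 : valuation F ((k : Matrix (Fin 2) (Fin 2) F) 0 1 * (k : Matrix (Fin 2) (Fin 2) F) 1 0) < 1 := by
    rw [map_mul]
    calc valuation F ((k : Matrix (Fin 2) (Fin 2) F) 0 1) * valuation F ((k : Matrix (Fin 2) (Fin 2) F) 1 0)
        ≤ 1 * valuation F ((k : Matrix (Fin 2) (Fin 2) F) 1 0) := mul_le_mul' (hle 0 1) le_rfl
      _ < 1 := by rw [one_mul]; exact h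
  have h2 : valuation F ((k : Matrix (Fin 2) (Fin 2) F) 0 0 * (k : Matrix (Fin 2) (Fin 2) F) 1 1) = 1 := by
    by_contra hne
    have hlt : valuation F ((k : Matrix (Fin 2) (Fin 2) F) 0 0 * (k : Matrix (Fin 2) (Fin 2) F) 1 1) < 1 :=
      lt_of_le_of_ne (by rw [map_mul]; exact mul_le_one' (hle 0 0) (hle 1 1)) hne
    have := Valuation.map_sub (valuation F) ((k : Matrix (Fin 2) (Fin 2) F) 0 0 * (k : Matrix (Fin 2) (Fin 2) F) 1 1)
      ((k : Matrix (Fin 2) (Fin 2) F) 0 1 * (k : Matrix (Fin 2) (Fin 2) F) 1 0)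
    rw [hdet] at this
    exact absurd this (not_le.2 (max_lt hlt h1))
  rw [map_mul] at h2
  exact valuation_eq_one_of_mul_eq_one (hle 0 0) (hle 1 1) h2

omit [ValuativeRel F] in
/-- The matrix of `[[1,0],[x,1]] · X`. [folklore] -/
theorem lowerUni_mul (x : F) (X : Matrix (Fin 2) (Fin 2) F) :
    (!![1, 0; x, 1] : Matrix (Fin 2) (Fin 2) F) * X = !![X 0 0, X 0 1; x * X 0 0 + X 1 0, x * X 0 1 + X 1 1] := by
  ext i j
  fin_cases i <;> fin_cases j <;> simp [Matrix.mul_apply, Fin.sum_univ_two]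

omit [ValuativeRel F] in
/-- The matrix of `[[0,1],[1,0]] · X` (row swap). [folklore] -/
theorem swap_mul (X : Matrix (Fin 2) (Fin 2) F) :
    (!![0, 1; 1, 0] : Matrix (Fin 2) (Fin 2) F) * X = !![X 1 0, X 1 1; X 0 0, X 0 1] := by
  ext i j
  fin_cases i <;> fin_cases j <;> simp [Matrix.mul_apply, Fin.sum_univ_two]

omit [ValuativeRel F] in
/-- The matrix of `[[0,1],[1,−t]] · X` (the inverse of `w(t) = [[t,1],[1,0]]`). [folklore] -/
theorem swapInv_mul (t : F) (X : Matrix (Fin 2) (Fin 2) F) :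
    (!![0, 1; 1, -t] : Matrix (Fin 2) (Fin 2) F) * X = !![X 1 0, X 1 1; X 0 0 - t * X 1 0, X 0 1 - t * X 1 1] := by
  ext i j
  fin_cases i <;> fin_cases j <;> simp [Matrix.mul_apply, Fin.sum_univ_two] <;> ring

omit [ValuativeRel F] in
/-- `[[1,0],[−x,1]] · [[1,0],[x,1]] = 1`. [folklore] -/
theorem lowerUni_neg_mul_lowerUni (x : F) :
    (!![1, 0; -x, 1] : Matrix (Fin 2) (Fin 2) F) * !![1, 0; x, 1] = 1 := by
  rw [lowerUni_mul]; ext i j; fin_cases i <;> fin_cases j <;> simp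

omit [ValuativeRel F] in
/-- `[[0,1],[1,−t]] · [[t,1],[1,0]] = 1`. [folklore] -/
theorem swapInv_mul_swapT (t : F) :
    (!![0, 1; 1, -t] : Matrix (Fin 2) (Fin 2) F) * !![t, 1; 1, 0] = 1 := by
  rw [swapInv_mul]; ext i j; fin_cases i <;> fin_cases j <;> simp

/-- **Right `B(𝒪)`-invariant functions are read off the cell coordinate (cell `K₁`)**: if `U ∈ K` has matrix `[[1,0],[s,1]]` with `s = k₁₀ ∕ k₀₀` then `U⁻¹ k` is
upper triangular, so `Ψ k = Ψ U` for every right-`B(𝒪)`-invariant `Ψ`. [cite: Serre1980Trees, Ch. II §1.1] -/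
theorem apply_eq_apply_lowerUni {Ψ : GL (Fin 2) F → ℝ≥0∞}
    (hΨ : ∀ k ∈ glInt 2 F, ∀ b ∈ glInt 2 F, ((b : GL (Fin 2) F) : Matrix (Fin 2) (Fin 2) F) 1 0 = 0 → Ψ (k * b) = Ψ k)
    {k U : GL (Fin 2) F} (hk : k ∈ glInt 2 F) (hU : U ∈ glInt 2 F) (h00 : (k : Matrix (Fin 2) (Fin 2) F) 0 0 ≠ 0)
    (hUm : (U : Matrix (Fin 2) (Fin 2) F) = !![1, 0; (k : Matrix (Fin 2) (Fin 2) F) 1 0 / (k : Matrix (Fin 2) (Fin 2) F) 0 0, 1]) :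
    Ψ k = Ψ U := by
  have hb : (((U⁻¹ * k : GL (Fin 2) F)) : Matrix (Fin 2) (Fin 2) F) 1 0 = 0 := by
    -- `U⁻¹` has matrix `[[1,0],[−s,1]]`
    have hinv : ((U⁻¹ : GL (Fin 2) F) : Matrix (Fin 2) (Fin 2) F) = !![1, 0; -((k : Matrix (Fin 2) (Fin 2) F) 1 0 / (k : Matrix (Fin 2) (Fin 2) F) 0 0), 1] := by
      have h1 : (!![1, 0; -((k : Matrix (Fin 2) (Fin 2) F) 1 0 / (k : Matrix (Fin 2) (Fin 2) F) 0 0), 1] : Matrix (Fin 2) (Fin 2) F) *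
          (U : Matrix (Fin 2) (Fin 2) F) = 1 := by rw [hUm]; exact lowerUni_neg_mul_lowerUni _
      calc ((U⁻¹ : GL (Fin 2) F) : Matrix (Fin 2) (Fin 2) F)
          = (!![1, 0; -((k : Matrix (Fin 2) (Fin 2) F) 1 0 / (k : Matrix (Fin 2) (Fin 2) F) 0 0), 1] * (U : Matrix (Fin 2) (Fin 2) F)) *
              ((U⁻¹ : GL (Fin 2) F) : Matrix (Fin 2) (Fin 2) F) := by rw [h1, Matrix.one_mul]
        _ = _ := by rw [Matrix.mul_assoc, ← Units.val_mul, mul_inv_cancel, Units.val_one, Matrix.mul_one]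
    rw [Units.val_mul, hinv, lowerUni_mul]
    simp only [Matrix.of_apply, Matrix.cons_val', Matrix.cons_val_zero, Matrix.cons_val_one, Matrix.cons_val_fin_one]
    field_simp
    ring
  calc Ψ k = Ψ (U * (U⁻¹ * k)) := by rw [mul_inv_cancel_left]
    _ = Ψ U := hΨ U hU (U⁻¹ * k) (Subgroup.mul_mem _ (Subgroup.inv_mem _ hU) hk) hb

/-- **Cell `K₂`**: if `W ∈ K` has matrix `[[t,1],[1,0]]` with `t = k₀₀ ∕ k₁₀` then `W⁻¹ k` is upper triangular, so `Ψ k = Ψ W`. [cite: Serre1980Trees, Ch. II §1.1] -/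
theorem apply_eq_apply_swapT {Ψ : GL (Fin 2) F → ℝ≥0∞}
    (hΨ : ∀ k ∈ glInt 2 F, ∀ b ∈ glInt 2 F, ((b : GL (Fin 2) F) : Matrix (Fin 2) (Fin 2) F) 1 0 = 0 → Ψ (k * b) = Ψ k)
    {k W : GL (Fin 2) F} (hk : k ∈ glInt 2 F) (hW : W ∈ glInt 2 F) (h10 : (k : Matrix (Fin 2) (Fin 2) F) 1 0 ≠ 0)
    (hWm : (W : Matrix (Fin 2) (Fin 2) F) = !![(k : Matrix (Fin 2) (Fin 2) F) 0 0 / (k : Matrix (Fin 2) (Fin 2) F) 1 0, 1; 1, 0]) :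
    Ψ k = Ψ W := by
  have hb : (((W⁻¹ * k : GL (Fin 2) F)) : Matrix (Fin 2) (Fin 2) F) 1 0 = 0 := by
    have hinv : ((W⁻¹ : GL (Fin 2) F) : Matrix (Fin 2) (Fin 2) F) = !![0, 1; 1, -((k : Matrix (Fin 2) (Fin 2) F) 0 0 / (k : Matrix (Fin 2) (Fin 2) F) 1 0)] := by
      have h1 : (!![0, 1; 1, -((k : Matrix (Fin 2) (Fin 2) F) 0 0 / (k : Matrix (Fin 2) (Fin 2) F) 1 0)] : Matrix (Fin 2) (Fin 2) F) *
          (W : Matrix (Fin 2) (Fin 2) F) = 1 := by rw [hWm]; exact swapInv_mul_swapT _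
      calc ((W⁻¹ : GL (Fin 2) F) : Matrix (Fin 2) (Fin 2) F)
          = (!![0, 1; 1, -((k : Matrix (Fin 2) (Fin 2) F) 0 0 / (k : Matrix (Fin 2) (Fin 2) F) 1 0)] * (W : Matrix (Fin 2) (Fin 2) F)) *
              ((W⁻¹ : GL (Fin 2) F) : Matrix (Fin 2) (Fin 2) F) := by rw [h1, Matrix.one_mul]
        _ = _ := by rw [Matrix.mul_assoc, ← Units.val_mul, mul_inv_cancel, Units.val_one, Matrix.mul_one]
    rw [Units.val_mul, hinv, swapInv_mul]
    simp only [Matrix.of_apply, Matrix.cons_val', Matrix.cons_val_zero, Matrix.cons_val_one, Matrix.cons_val_fin_one]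
    field_simp
    ring
  calc Ψ k = Ψ (W * (W⁻¹ * k)) := by rw [mul_inv_cancel_left]
    _ = Ψ W := hΨ W hW (W⁻¹ * k) (Subgroup.mul_mem _ (Subgroup.inv_mem _ hW) hk) hb

/-- `[[1,0],[x,1]] ∈ GL₂(𝒪)` exists for `|x| ≤ 1` (★ `exists_mem_glInt_coe_eq_lowerUnipotent`). [cite: Serre1980Trees, Ch. II §1.1] -/
theorem exists_glInt_lowerUni {x : F} (hx : valuation F x ≤ 1) :
    ∃ U : GL (Fin 2) F, (U : Matrix (Fin 2) (Fin 2) F) = !![1, 0; x, 1] ∧ U ∈ glInt 2 F :=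
  exists_mem_glInt_coe_eq_lowerUnipotent F ((Valuation.mem_integer_iff _ _).2 hx)

/-- `w(t) = [[t,1],[1,0]] = w · n⁻(t) ∈ GL₂(𝒪)` exists for `|t| ≤ 1`. [cite: Serre1980Trees, Ch. II §1.1] -/
theorem exists_glInt_swapT {t : F} (ht : valuation F t ≤ 1) :
    ∃ W : GL (Fin 2) F, (W : Matrix (Fin 2) (Fin 2) F) = !![t, 1; 1, 0] ∧ W ∈ glInt 2 F := by
  obtain ⟨w, hwm, hw⟩ := HermitianLatticeTree.exists_mem_glInt_coe_eq_swap (F := F)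
  obtain ⟨U, hUm, hU⟩ := exists_glInt_lowerUni ht
  refine ⟨w * U, ?_, Subgroup.mul_mem _ hw hU⟩
  rw [Units.val_mul, hwm, hUm, swap_mul]
  ext i j; fin_cases i <;> fin_cases j <;> simp

/-! ## §2  The averaging lemma: a finite measure on `F` carried by `𝒪` and invariant under `𝒪`-translations is `c · dx|_𝒪` -/

section Averaging
variable [TopologicalSpace F] [IsNonarchimedeanLocalField F] [MeasurableSpace F] [BorelSpace F]

/-- **THE AVERAGING LEMMA (mass form).**  `dx` an additive Haar measure on `F`, `m` a finite measure on `F` carried by `𝒪 = primePowBall F 0` and invariant under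
translation by every element of `𝒪`: `m(A) · dx(𝒪) = m(𝒪) · dx(A ∩ 𝒪)` for every measurable `A` (Tonelli on `(x, y) ↦ 1_A(y + x)` over `𝒪 × F`).
[cite: Folland1995, §2.2 Thm. 2.20] -/
theorem measure_mul_measure_eq_of_forall_preimage_add (dx : Measure F) [dx.IsAddHaarMeasure] (m : Measure F) [IsFiniteMeasure m]
    (hmO : m (primePowBall F 0)ᶜ = 0)
    (hinv : ∀ x ∈ primePowBall F 0, ∀ A : Set F, MeasurableSet A → m ((fun y => y + x) ⁻¹' A) = m A)
    {A : Set F} (hA : MeasurableSet A) :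
    m A * dx (primePowBall F 0) = m (primePowBall F 0) * dx (A ∩ primePowBall F 0) := by
  haveI : T2Space F := (isLocalField F).toT2Space
  haveI : SecondCountableTopology F := secondCountableTopology_localField F
  have hO : MeasurableSet (primePowBall F 0) := (isClosed_primePowBall 0).measurableSet
  have hmeas : Measurable fun p : F × F => A.indicator (1 : F → ℝ≥0∞) (p.2 + p.1) :=
    (measurable_one.indicator hA).comp (measurable_snd.add measurable_fst)
  -- (i) the inner `m`-integral is `m A` for `x ∈ 𝒪`
  have h1 : ∀ x ∈ primePowBall F 0, ∫⁻ y, A.indicator (1 : F → ℝ≥0∞) (y + x) ∂m = m A := by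
    intro x hx
    have : (fun y => A.indicator (1 : F → ℝ≥0∞) (y + x)) = ((fun y => y + x) ⁻¹' A).indicator 1 := by
      funext y
      by_cases h : y + x ∈ A
      · rw [Set.indicator_of_mem h, Set.indicator_of_mem (show y ∈ (fun y => y + x) ⁻¹' A from h)]; rfl
      · rw [Set.indicator_of_notMem h, Set.indicator_of_notMem (show y ∉ (fun y => y + x) ⁻¹' A from h)]
    rw [this, lintegral_indicator_one ((measurable_add_const x) hA), hinv x hx A hA]
  -- (ii) the inner `dx`-integral over `𝒪` is `dx(A ∩ 𝒪)` for `y ∈ 𝒪`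
  have h2 : ∀ y ∈ primePowBall F 0, ∫⁻ x in primePowBall F 0, A.indicator (1 : F → ℝ≥0∞) (y + x) ∂dx = dx (A ∩ primePowBall F 0) := by
    intro y hy
    have : (fun x => A.indicator (1 : F → ℝ≥0∞) (y + x)) = ((fun x => y + x) ⁻¹' A).indicator 1 := by
      funext x
      by_cases h : y + x ∈ A
      · rw [Set.indicator_of_mem h, Set.indicator_of_mem (show x ∈ (fun x => y + x) ⁻¹' A from h)]; rfl
      · rw [Set.indicator_of_notMem h, Set.indicator_of_notMem (show x ∉ (fun x => y + x) ⁻¹' A from h)]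
    rw [this, lintegral_indicator_one ((measurable_const_add y) hA), Measure.restrict_apply ((measurable_const_add y) hA)]
    have hset : (fun x => y + x) ⁻¹' A ∩ primePowBall F 0 = (fun x => y + x) ⁻¹' (A ∩ primePowBall F 0) := by
      ext x
      simp only [Set.mem_inter_iff, Set.mem_preimage]
      constructor
      · rintro ⟨h1, h2⟩; exact ⟨h1, add_mem_primePowBall hy h2⟩
      · rintro ⟨h1, h2⟩
        refine ⟨h1, ?_⟩
        have : x = -y + (y + x) := by abel
        rw [this]; exact add_mem_primePowBall (neg_mem_primePowBall hy) h2
    rw [hset, measure_preimage_add]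
  -- Tonelli
  have hI1 : ∫⁻ x in primePowBall F 0, ∫⁻ y, A.indicator (1 : F → ℝ≥0∞) (y + x) ∂m ∂dx = m A * dx (primePowBall F 0) := by
    rw [setLIntegral_congr_fun hO h1, setLIntegral_const]
  have hI2 : ∫⁻ x in primePowBall F 0, ∫⁻ y, A.indicator (1 : F → ℝ≥0∞) (y + x) ∂m ∂dx = m (primePowBall F 0) * dx (A ∩ primePowBall F 0) := by
    rw [lintegral_lintegral_swap (hmeas.aemeasurable)]
    have hae : ∀ᵐ y ∂m, y ∈ primePowBall F 0 := by
      rw [ae_iff]; exact hmO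
    rw [lintegral_congr_ae (hae.mono fun y hy => h2 y hy), lintegral_const, mul_comm]
    congr 1
    rw [← measure_add_measure_compl (μ := m) hO, hmO, add_zero]
  rw [← hI1, hI2]

/-- **THE AVERAGING LEMMA (measure form)**: such an `m` IS `(m(𝒪) ∕ dx(𝒪)) · dx|_𝒪` — the additive, compact-open-subgroup case of Haar uniqueness on a window
(★ `Literature.MeasureTheory.Group.HaarLocalChart`, multiplicative groups).  [cite: Folland1995, §2.2 Thm. 2.20] -/
theorem eq_smul_restrict_of_forall_preimage_add (dx : Measure F) [dx.IsAddHaarMeasure] (m : Measure F) [IsFiniteMeasure m]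
    (hmO : m (primePowBall F 0)ᶜ = 0)
    (hinv : ∀ x ∈ primePowBall F 0, ∀ A : Set F, MeasurableSet A → m ((fun y => y + x) ⁻¹' A) = m A) :
    m = (m (primePowBall F 0) / dx (primePowBall F 0)) • dx.restrict (primePowBall F 0) := by
  haveI : T2Space F := (isLocalField F).toT2Space
  haveI : LocallyCompactSpace F := (isLocalField F).toLocallyCompactSpace
  have hO0 : dx (primePowBall F 0) ≠ 0 := ((isOpen_primePowBall 0).measure_pos dx ⟨0, zero_mem_primePowBall 0⟩).ne'
  have hOt : dx (primePowBall F 0) ≠ ⊤ := (isCompact_primePowBall 0).measure_lt_top.ne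
  ext A hA
  have h := measure_mul_measure_eq_of_forall_preimage_add dx m hmO hinv hA
  rw [Measure.smul_apply, smul_eq_mul, Measure.restrict_apply hA, ← ENNReal.mul_div_right_comm,
    ENNReal.eq_div_iff hO0 hOt, mul_comm]
  exact h

end Averaging

end Summit.HodgeConjecture.HodgeConjecture.Cruxes.H413.K2E3GL2IntegralPointsCellLemmas

end
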